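import Summits.KontsevichZagierPeriods.KontsevichZagierPeriods.Theses.SpheresForWalls
import Summits.KontsevichZagierPeriods.KontsevichZagierPeriods.Theorems.SymplecticScissorsCubeNashNormalForm
import Summits.KontsevichZagierPeriods.KontsevichZagierPeriods.Theorems.CompiledSubstitutionsPiNormalisation
import Literature.NumberTheory.Transcendental.KZSemiCanonicalReductionHolds
import Literature.NumberTheory.Transcendental.KZProductIdeal
import Literature.NumberTheory.Transcendental.KZCalculusProofs
import Literature.NumberTheory.Transcendental.SemialgebraicMapsProofs

/-!
# `SpinNormalForm` (stmt-KontsevichZagierPeriods-16456, route SpheresForWalls, crux rank 2) — line `landed-cubes`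

Strategist line (cstrat r1, 2026-08-17) for the crux — verbatim the route decl
`…Theses.SpheresForWalls.SpinNormalForm` (rev 1, P-pinned form; `spinNormalForm_iff` below is `Iff.rfl`):
for every PINNED DISC PADDING `P n r = [{z₀² + z₁² ≤ 1} × σ, f ∘ tail²]` and every `r` of dimension `n`
there is `N₀` with, for every `N ≥ N₀`, ONE spherical representation `R` of some dimension `2m` (`Sph m R`:
domain `ℝ^{2m}`, density analytic everywhere and in each of the `2^m` inversion charts) such that
`(twist P)^[N] [r] − [R] ∈ KZ.relations`.

## Why a second line: the content stub of `Lines/birth.lean` is ALREADY LANDED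

`Lines/birth.lean` (the registered skeleton) carries the whole difficulty in its XL stub
`stub_cubeNormalForm` ("every representation is a sum of good cubes": compactify, resolve, Abhyankar–Jung,
cubulate). But the tree ALREADY PROVES a cube normal form: the shared crux `CubeNashNormalForm`
(stmt-KontsevichZagierPeriods-3574; decls `LiftingCriteria/SymplecticScissors/DimensionBudget.CubeNashNormalForm`,
closed by `Theorems/SymplecticScissorsCubeNashNormalForm.lean`, Jung descent + Abhyankar–Jung + toric
principalization): for RATIONAL `r, r'`, `[r] − [r'] ≡ Σᵢ εᵢ [sᵢ]` with `sᵢ` NASH CUBES (closed unit cubes of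
various dimensions `dᵢ`, integrand `= gᵢ` on the cube, `gᵢ` `ℚ`-semialgebraic and real-analytic on an open
`Uᵢ ⊇ [0,1]^{dᵢ}`, `εᵢ ∈ ℤ`). Together with the landed Viu-Sos packaging
(`KZ.exists_sub_add_mem_relations_sign`, `KZ.exists_boundedVolume_sub_mem_relations`: every `r` is
`≡ [A] − [B]` with `A`, `B` bounded volumes = integrand `1`, hence rational) this gives `cubeForm` below —
PROVED here, no hypothesis on `r`. The differences with birth's `IsGoodCube` (closed vs open cube, varying
dimensions, `ℤ`-coefficients) are absorbed by the sorry-free composition. Likewise birth's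
`stub_twistIdeal` is PROVED here (`twistIdeal`: a pinned padding is `[π] × r` reindexed ON THE NOSE,
`pad_eq`; `KZ.of_mul_mem_relations` + `KZ.of_sub_of_reindex_mem_relations`, KZProductIdeal), and the climb
`N ≥ N₀` by `TwistStable` is REPLACED by padding the cubes with unit intervals BEFORE spinning (`cubePad`,
PROVED: the slab `s × [0,1]` is one Newton–Leibniz move, `KZ.IntegralRep.equivalent_slab`, and is again a
Nash cube). What remains is Archimedes' hat-box, cut in two honest pieces:

* `stub_flatten` (M, product calculus): `(twist P)^[d] [s] ≡ [F]`, `F = [ℝᵈ × σ, ∏ₖ (1+tₖ²)⁻¹ · f]`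
  (`IsFlat`; the Cauchy line `[ℝ, 1/(1+t²)] ≡ [π]` is the LANDED `PiNormalisation`, `cauchy_sub_piRep`
  below, and `relations` is a two-sided ideal, `KZ.mul_sub_mul_mem_relations`);
* `stub_productSpin` (L, the one geometric step): for a Nash cube `s`, `[F] ≡ [R]` with `Sph d R`, by ONE
  explicit semialgebraic change of variables per plane, `φ(t, x) = √(x/(1−x))·((1−t²)/(1+t²), 2t/(1+t²))`
  (`|det Dφ| = (1−x)⁻²(1+t²)⁻¹`, `1+|φ|² = (1−x)⁻¹`), null sets by move (1a), and the chart check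
  (`z ↦ 1 − z`, analytic because `g` is analytic ACROSS the faces of the closed cube).

Composition `SpinNormalForm_of : stub_flatten-sig → stub_productSpin-sig → SpinNormalForm` (sorry-free):
`[r] ≡ Σᵢ εᵢ [sᵢ]` (`cubeForm`); `N₀ := Σᵢ dᵢ`; for `N ≥ N₀` pad each `sᵢ` to dimension `N` (`cubePad_add`),
push through `κ^N` (`twistIdeal`: iterates preserve relations and commute with `ℤ`-combinations), flatten
and spin each padded cube to a spherical `[Rᵢ]` of dimension `2N`, merge `Σᵢ εᵢ [Rᵢ] ≡ [R₀]`
(`exists_sph_zsum`, PROVED: integrand additivity on the common domain `ℝ^{2N}`, chart densities add).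
`SpinNormalForm_skeleton : SpinNormalForm` feeds the two stubs in; its only `sorryAx` dependencies are
`stub_flatten`, `stub_productSpin`.

Disproof used: none on file for this crux (`ledger crux ls stmt-KontsevichZagierPeriods-16456`: no
`Disproof.lean`, no `Theorems/…/Negative/*`; `ledger negatives --problem KontsevichZagierPeriods`: nothing on
spherical / cube normal forms). Dead lines: none recorded. Why it dodges the stuck point of `birth`: the XL
stub `stub_cubeNormalForm` (no registered sub-plan; "global C^ω cubulation … not in print") is not attacked
but BYPASSED — its Nash-cube variant is a theorem of the tree. Provers of a stub
`import Summits.KontsevichZagierPeriods.KontsevichZagierPeriods.Cruxes.SpinNormalForm.Lines.landed_cubes`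
(or copy the BEGIN/END VOCAB block) and `open …Cruxes.SpinNormalForm.LandedCubes`.
-/

set_option linter.dupNamespace false

namespace Summit.KontsevichZagierPeriods.KontsevichZagierPeriods.Cruxes.SpinNormalForm.LandedCubes

open scoped BigOperators
open MeasureTheory Set
open Literature.NumberTheory.Transcendental
open Summit.KontsevichZagierPeriods.KontsevichZagierPeriods.Theses.SpheresForWalls (SpinNormalForm)

-- BEGIN VOCAB (copied verbatim into the probe files)
/-! ### The crux's vocabulary, named — literal bodies (identical to `Lines/birth.lean`) -/

/-- **Spherical representation of dimension `2m`** (verbatim the `let Sph` of the crux): domain all of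
`ℝ^{2m}` and, for every choice `ε` of coordinate planes to invert (`w_k ↦ w_k/|w_k|²`, Jacobian
`|w_k|⁻⁴`), an everywhere-analytic `K` agreeing with the pulled-back density off the inverted planes'
origins — an analytic density on `(S²)^m`. [cite: KontsevichZagier2001, §1.2] -/
def Sph (m : ℕ) (R : KZ.IntegralRep (m * 2)) : Prop :=
  R.domain = Set.univ ∧ ∀ ε : Fin m → Bool, ∃ K : (Fin (m * 2) → ℝ) → ℝ, (∀ w, AnalyticAt ℝ K w) ∧
    ∀ w : Fin (m * 2) → ℝ, (∀ k : Fin m, ε k = true →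
      w (finProdFinEquiv (k, (0 : Fin 2))) ^ 2 + w (finProdFinEquiv (k, (1 : Fin 2))) ^ 2 ≠ 0) →
      K w = R.integrand (fun i : Fin (m * 2) => if ε (finProdFinEquiv.symm i).1 = true then
        w i / (w (finProdFinEquiv ((finProdFinEquiv.symm i).1, (0 : Fin 2))) ^ 2 +
          w (finProdFinEquiv ((finProdFinEquiv.symm i).1, (1 : Fin 2))) ^ 2) else w i) *
        ∏ k : Fin m, (if ε k = true then ((w (finProdFinEquiv (k, (0 : Fin 2))) ^ 2 +
          w (finProdFinEquiv (k, (1 : Fin 2))) ^ 2)⁻¹) ^ 2 else 1)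

/-- **Pinned disc padding** (verbatim the pinning clause of the crux): `P n r` has domain
`{z₀² + z₁² ≤ 1} × σ` and integrand `f ∘ tail²`. [cite: KontsevichZagier2001, §1.2] -/
def IsDiscPad (P : ∀ n : ℕ, KZ.IntegralRep n → KZ.IntegralRep (n + 2)) : Prop :=
  ∀ (n : ℕ) (r : KZ.IntegralRep n), (P n r).domain = {z : Fin (n + 2) → ℝ | z 0 ^ 2 + z 1 ^ 2 ≤ 1 ∧
    (fun i : Fin n => z i.succ.succ) ∈ r.domain} ∧
    (P n r).integrand = fun z => r.integrand (fun i : Fin n => z i.succ.succ)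

/-- **The twist `κ = [π]⋆`** (verbatim the crux's `FreeAbelianGroup.lift (fun s => KZ.of (P s.1 s.2))`):
the additive extension of the padding to formal combinations. [cite: KontsevichZagier2001, §1.2] -/
def twist (P : ∀ n : ℕ, KZ.IntegralRep n → KZ.IntegralRep (n + 2)) : KZ.FormalRep →+ KZ.FormalRep :=
  FreeAbelianGroup.lift (fun s : (Σ n, KZ.IntegralRep n) => KZ.of (P s.1 s.2))

/-- **Nash cube** of dimension `d` — EXACTLY the output format of the landed crux `CubeNashNormalForm`
(stmt-KontsevichZagierPeriods-3574): domain the CLOSED unit cube `[0,1]ᵈ`, integrand agreeing on it with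
a function `g` that is `ℚ`-semialgebraic AND real-analytic on an open neighbourhood `U` of the closed
cube. [cite: KontsevichZagier2001, §1.2] [cite: ViuSos2021, Thm. 1.1] -/
def IsNashCube (d : ℕ) (s : KZ.IntegralRep d) : Prop :=
  s.domain = Set.pi Set.univ (fun _ : Fin d => Set.Icc (0 : ℝ) 1) ∧
    ∃ (U : Set (Fin d → ℝ)) (g : (Fin d → ℝ) → ℝ), IsOpen U ∧
      Set.pi Set.univ (fun _ : Fin d => Set.Icc (0 : ℝ) 1) ⊆ U ∧
      IsSemialgebraicFunOn ℚ U g ∧ AnalyticOnNhd ℝ g U ∧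
      ∀ z ∈ Set.pi Set.univ (fun _ : Fin d => Set.Icc (0 : ℝ) 1), s.integrand z = g z

/-- **Flattened form** of a representation `s` of dimension `d` after `d` twists: `d` CAUCHY LINES
`[ℝ, 1/(1+t²)]` in the leading block of coordinates (`Fin.castAdd d k`), the original representation in
the trailing block (`Fin.natAdd d i`) — the layout of `KZ.IntegralRep.prodDomain`/`prodFun`:
domain `ℝᵈ × σ`, integrand `(∏ₖ 1/(1+tₖ²)) · f(x)`. [cite: KontsevichZagier2001, §1.1 eq. (1), §4.1] -/
def IsFlat (d : ℕ) (s : KZ.IntegralRep d) (F : KZ.IntegralRep (d + d)) : Prop :=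
  F.domain = {z : Fin (d + d) → ℝ | (fun i : Fin d => z (Fin.natAdd d i)) ∈ s.domain} ∧
    F.integrand = fun z => (∏ k : Fin d, 1 / (1 + z (Fin.castAdd d k) ^ 2)) *
      s.integrand (fun i : Fin d => z (Fin.natAdd d i))

-- END VOCAB

/-- The twist of a generator is the padded generator. [cite: KontsevichZagier2001, §1.2] -/
theorem twist_of (P : ∀ n : ℕ, KZ.IntegralRep n → KZ.IntegralRep (n + 2)) {d : ℕ} (r : KZ.IntegralRep d) :
    twist P (KZ.of r) = KZ.of (P d r) :=
  FreeAbelianGroup.lift_apply_of _ _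

/-- **The crux through the named vocabulary** — DEFINITIONAL (`Iff.rfl`): certifies that `Sph`,
`IsDiscPad`, `twist` are literally the crux's `let`-body, pinning clause and twist.
[cite: KontsevichZagier2001, §1.2] -/
theorem spinNormalForm_iff :
    SpinNormalForm ↔ ∀ P : ∀ n : ℕ, KZ.IntegralRep n → KZ.IntegralRep (n + 2), IsDiscPad P →
      ∀ (n : ℕ) (r : KZ.IntegralRep n), ∃ N₀ : ℕ, ∀ N : ℕ, N₀ ≤ N →
        ∃ (m : ℕ) (R : KZ.IntegralRep (m * 2)), Sph m R ∧
          (⇑(twist P))^[N] (KZ.of r) - KZ.of R ∈ KZ.relations :=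
  Iff.rfl

/-! ### The two statements of the line (named; each is registered below as a `stub_…`) -/

/-- **(F) Flatten** — the statement of `stub_flatten` (product calculus; M). -/
def Flatten : Prop :=
  ∀ P : ∀ n : ℕ, KZ.IntegralRep n → KZ.IntegralRep (n + 2), IsDiscPad P →
    ∀ (d : ℕ) (s : KZ.IntegralRep d), ∃ F : KZ.IntegralRep (d + d), IsFlat d s F ∧
      (⇑(twist P))^[d] (KZ.of s) - KZ.of F ∈ KZ.relations

/-- **(S) Product spin** — the statement of `stub_productSpin` (one explicit semialgebraic change of
variables; L). -/
def ProductSpin : Prop :=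
  ∀ (d : ℕ) (s : KZ.IntegralRep d), IsNashCube d s → ∀ F : KZ.IntegralRep (d + d), IsFlat d s F →
    ∃ R : KZ.IntegralRep (d * 2), Sph d R ∧ KZ.of F - KZ.of R ∈ KZ.relations

/-! ### Registered stubs (the only `sorry`s of this file) -/

/-- **STUB F — FLATTEN** (M; provable now, product calculus only). For a pinned disc padding `P` and ANY
representation `s` of dimension `d`, the `d`-fold twist `(twist P)^[d] [s] = [D̄ × ⋯ × D̄ × σ, f ∘ tail]`
is congruent modulo `KZ.relations` to ONE flattened representation `F` (`IsFlat d s F`: `d` Cauchy lines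
`[ℝ, 1/(1+t²)]` in the leading block, `s` in the trailing block). Proof plan, all landed:
`twist_sub_mul_mem` (this file: `twist P x − [π]·x ∈ relations`), `twistIdeal` (this file),
`cauchy_sub_piRep` (this file, from the landed `PiNormalisation`: `[ℝ, 1/(1+t²)] − [π] ∈ relations`),
the two-sided ideal `KZ.mul_sub_mul_mem_relations` (replace each factor `[π]` by the Cauchy line inside
the product), `KZ.of_mul_of` (products of generators are product representations,
`KZ.IntegralRep.prod_integrand_of` + `KZ.prodFunSemialgebraic_holds`), and coordinate bookkeeping from
the nested layout `1 + (1 + ⋯ (1 + d))` to the block layout `d + d` by `KZ.of_sub_of_reindex_mem_relations`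
+ `KZ.IntegralRep.ext'` (induction on `d`). Why it might fail: it should not (Fin arithmetic only).
[cite: KontsevichZagier2001, §1.1 eq. (1), §1.2, §4.1] -/
theorem stub_flatten :
    ∀ P : ∀ n : ℕ, KZ.IntegralRep n → KZ.IntegralRep (n + 2), IsDiscPad P →
      ∀ (d : ℕ) (s : KZ.IntegralRep d), ∃ F : KZ.IntegralRep (d + d), IsFlat d s F ∧
        (⇑(twist P))^[d] (KZ.of s) - KZ.of F ∈ KZ.relations := by
  sorry

/-- **STUB S — PRODUCT SPIN** (L; provable now; the only geometric step of the line). For a Nash cube `s`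
of dimension `d` (`IsNashCube`: closed cube, integrand `= g` on it, `g` semialgebraic-analytic on an open
`U ⊇ [0,1]ᵈ`) and its flattened form `F = [ℝᵈ × [0,1]ᵈ, ∏ₖ (1+tₖ²)⁻¹ · g(x)]`, there is ONE spherical
representation `R` of dimension `2d` (`Sph d R`) with `[F] − [R] ∈ relations`. Proof plan: drop the null
boundary `ℝᵈ × ∂[0,1]ᵈ` (`KZ.IntegralRep.of_sub_of_restrict_mem_relations`); ONE change-of-variables move
`Φ = ∏ₖ φ`, `φ (t, x) = √(x/(1−x)) · ((1−t²)/(1+t²), 2t/(1+t²)) ∈ ℝ²` (semialgebraic, injective on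
`ℝ × (0,1)`, `|det Dφ| = (1−x)⁻² (1+t²)⁻¹`, and `1 + |φ|² = (1−x)⁻¹`, `|φ|²/(1+|φ|²) = x`), so
`(1+t²)⁻¹ g(…, x, …) = [(1+|w|²)⁻² g(…, |w|²/(1+|w|²), …)] ∘ φ · |det Dφ|` — it may be applied one plane
at a time with the other coordinates as spectators; the image misses only the null set
`⋃ₖ {wₖ ∈ {0} ∪ ray}` (move (1a) to `ℝ^{2d}`); reindex to the `finProdFinEquiv` layout; finally
`R = [ℝ^{2d}, g(z(w₁), …, z(w_d)) ∏ₖ (1+|wₖ|²)⁻²]`, `z(w) = |w|²/(1+|w|²)`, is spherical: in the inversion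
chart `wₖ ↦ wₖ/|wₖ|²` one has `z ↦ 1 − z` and `(1+|wₖ|²)⁻² |wₖ|⁻⁴ ↦ (1+|wₖ|²)⁻²`, analytic BECAUSE `g` is
analytic on a neighbourhood of the CLOSED cube (values `z ∈ [0,1)` and `1 − z ∈ (0,1]`); semialgebraicity
of the density by `IsSemialgebraicFunOn.comp_isSemialgebraicMapOn_holds`, integrability by `|g| ≤ M` on
the compact cube. The route's calibrations `UnitIntervalSpin`/`LogTwoSpin` (stmt-16460/16461, PROVED) are
`d = 1`. Why it might fail: Lean bookkeeping only (explicit `2d`-dimensional Jacobian, `finProdFinEquiv`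
layout); mathematically Archimedes' hat-box theorem. [cite: KontsevichZagier2001, §1.1 eq. (1), §1.2]
[cite: DuistermaatHeckman1982] -/
theorem stub_productSpin :
    ∀ (d : ℕ) (s : KZ.IntegralRep d), IsNashCube d s → ∀ F : KZ.IntegralRep (d + d), IsFlat d s F →
      ∃ R : KZ.IntegralRep (d * 2), Sph d R ∧ KZ.of F - KZ.of R ∈ KZ.relations := by
  sorry

/-! ### Consistency: each named statement IS its registered stub (definitionally) -/

theorem flatten_holds : Flatten := stub_flatten
theorem productSpin_holds : ProductSpin := stub_productSpin

/-! ### Name-keyed aliases of the two statements — the hypotheses of `SpinNormalForm_of`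
(device of `Lines/birth.lean`: the skeleton audit admits a hypothesis whose head constant is named like a
registered stub; each alias is `rfl`-equal to its statement). -/
namespace __Registered

/-- Alias of `Flatten` keyed by the registered stub name. -/
abbrev stub_flatten : Prop := Flatten
/-- Alias of `ProductSpin` keyed by the registered stub name. -/
abbrev stub_productSpin : Prop := ProductSpin

end __Registered

/-! ### LANDED INPUT 1 (sorry-free): the cube normal form, from `CubeNashNormalForm` (stmt-3574, proved)
and the Viu-Sos packaging (`KZSemiCanonicalReductionHolds`) -/

/-- A bounded volume (integrand `1` on its domain) has KZ's literal rational shape (`p = q = 1`).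
[cite: KontsevichZagier2001, §1.1] -/
theorem isRational_of_integrand_one {k : ℕ} (C : KZ.IntegralRep k)
    (hC : ∀ z ∈ C.domain, C.integrand z = 1) : C.IsRational := by
  refine ⟨1, 1, fun x _ => by simp, fun x hx => ?_⟩
  simp [hC x hx]

/-- **Cube form in every dimension (PROVED).** Every integral representation `r` (any dimension, no
rationality hypothesis) is congruent modulo `KZ.relations` to a `ℤ`-combination of Nash cubes of various
dimensions: `[r] ≡ [p] − [q]` with `p, q ≥ 0` (`KZ.exists_sub_add_mem_relations_sign`), `[p] ≡ [A]`,
`[q] ≡ [B]` with `A`, `B` bounded volumes one dimension up (`KZ.exists_boundedVolume_sub_mem_relations`,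
Viu-Sos), which are rational, and `[A] − [B] ≡ Σ εᵢ [sᵢ]` with Nash cubes `sᵢ` by the LANDED crux
`CubeNashNormalForm` (`…SymplecticScissors.CubeNashNormalForm.cubeNashNormalForm_proof`, Jung descent +
Abhyankar–Jung + toric principalization). This discharges the XL content stub `stub_cubeNormalForm` of
`Lines/birth.lean` up to the cube format (closed Nash cubes of varying dimension, `ℤ`-coefficients),
which the composition below absorbs. [cite: KontsevichZagier2001, §1.2] [cite: ViuSos2021, Thm. 1.1] -/
theorem cubeForm (n : ℕ) (r : KZ.IntegralRep n) :
    ∃ (S : ℕ) (d : Fin S → ℕ) (ε : Fin S → ℤ) (s : (i : Fin S) → KZ.IntegralRep (d i)),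
      (∀ i, IsNashCube (d i) (s i)) ∧ KZ.of r - ∑ i, ε i • KZ.of (s i) ∈ KZ.relations := by
  obtain ⟨p, q, hp, hq, hpq⟩ := KZ.exists_sub_add_mem_relations_sign r
  obtain ⟨A, -, hA1, hA⟩ := KZ.exists_boundedVolume_sub_mem_relations p hp
  obtain ⟨B, -, hB1, hB⟩ := KZ.exists_boundedVolume_sub_mem_relations q hq
  obtain ⟨S, d, g, U, ε, s, hgU, hs, hrel⟩ :=
    Summit.KontsevichZagierPeriods.SymplecticScissors.CubeNashNormalForm.cubeNashNormalForm_proof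
      (n + 1) (n + 1) A B (isRational_of_integrand_one A hA1) (isRational_of_integrand_one B hB1)
  refine ⟨S, d, ε, s, fun i => ⟨(hs i).1, U i, g i, (hgU i).1, (hgU i).2.1, (hgU i).2.2.1,
    (hgU i).2.2.2, (hs i).2⟩, ?_⟩
  have : KZ.of r - ∑ i, ε i • KZ.of (s i) =
      (KZ.of r - KZ.of p + KZ.of q) + (KZ.of p - KZ.of A) - (KZ.of q - KZ.of B) +
        (KZ.of A - KZ.of B - ∑ i, ε i • KZ.of (s i)) := by abel
  rw [this]
  exact KZ.relations.add_mem (KZ.relations.sub_mem (KZ.relations.add_mem hpq hA) hB) hrel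

/-! ### LANDED INPUT 2 (sorry-free): the twist is `[π]·` modulo relations, hence preserves relations
(`KZProductIdeal`) — discharges `stub_twistIdeal` of `Lines/birth.lean` -/

/-- **A pinned padding IS the product with `[π]`, reindexed**: `P n r = ([π] × r).reindex e` ON THE NOSE,
`e : Fin (2 + n) ≃ Fin (n + 2)` the cast. [cite: KontsevichZagier2001, §4.1] -/
theorem pad_eq {P : ∀ n : ℕ, KZ.IntegralRep n → KZ.IntegralRep (n + 2)} (hP : IsDiscPad P)
    (n : ℕ) (r : KZ.IntegralRep n) :
    P n r = (KZ.piRep.prod r).reindex (finCongr (Nat.add_comm 2 n)) := by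
  obtain ⟨hd, hi⟩ := hP n r
  have e0 : (finCongr (Nat.add_comm 2 n)) (Fin.castAdd n (0 : Fin 2)) = (0 : Fin (n + 2)) :=
    Fin.ext (by simp)
  have e1 : (finCongr (Nat.add_comm 2 n)) (Fin.castAdd n (1 : Fin 2)) = (1 : Fin (n + 2)) :=
    Fin.ext (by simp)
  have e2 : ∀ i : Fin n, (finCongr (Nat.add_comm 2 n)) (Fin.natAdd 2 i) = i.succ.succ := fun i =>
    Fin.ext (by simp only [finCongr_apply, Fin.val_cast, Fin.val_natAdd, Fin.val_succ]; omega)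
  apply KZ.IntegralRep.ext'
  · rw [hd]
    ext z
    simp only [KZ.IntegralRep.reindex_domain, KZ.IntegralRep.prod_domain, Set.mem_setOf_eq,
      KZ.IntegralRep.mem_prodDomain, KZ.piRep_domain, KZ.mem_piDisc, e0, e1, e2]
  · rw [hi]
    funext z
    simp only [KZ.IntegralRep.reindex_integrand, KZ.IntegralRep.piRep_prod_integrand,
      KZ.IntegralRep.prodFun_apply, KZ.piRep_integrand, one_mul, e2]

/-- **`twist P x − [π]·x ∈ relations` for every formal combination `x`** (reindexing is a
change-of-variables move, `KZ.of_sub_of_reindex_mem_relations`; induction on the free abelian group).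
[cite: KontsevichZagier2001, §1.2 rule (2), §4.1] -/
theorem twist_sub_mul_mem {P : ∀ n : ℕ, KZ.IntegralRep n → KZ.IntegralRep (n + 2)} (hP : IsDiscPad P)
    (x : KZ.FormalRep) : twist P x - KZ.of KZ.piRep * x ∈ KZ.relations := by
  induction x using FreeAbelianGroup.induction_on with
  | zero => simp [KZ.relations.zero_mem]
  | of s =>
    obtain ⟨d, r⟩ := s
    have h1 : twist P (FreeAbelianGroup.of ⟨d, r⟩) = KZ.of (P d r) := twist_of P r
    have h2 : KZ.of KZ.piRep * FreeAbelianGroup.of ⟨d, r⟩ = KZ.of (KZ.piRep.prod r) :=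
      KZ.of_mul_of KZ.piRep r
    rw [h1, h2, pad_eq hP]
    have h := KZ.relations.neg_mem
      (KZ.of_sub_of_reindex_mem_relations (KZ.piRep.prod r) (finCongr (Nat.add_comm 2 d)))
    rwa [neg_sub] at h
  | neg s ih =>
    have : twist P (-FreeAbelianGroup.of s) - KZ.of KZ.piRep * -FreeAbelianGroup.of s =
        -(twist P (FreeAbelianGroup.of s) - KZ.of KZ.piRep * FreeAbelianGroup.of s) := by
      rw [map_neg, mul_neg]; abel
    rw [this]
    exact KZ.relations.neg_mem ih
  | add x y hx hy =>
    have : twist P (x + y) - KZ.of KZ.piRep * (x + y) =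
        (twist P x - KZ.of KZ.piRep * x) + (twist P y - KZ.of KZ.piRep * y) := by
      rw [map_add, mul_add]; abel
    rw [this]
    exact KZ.relations.add_mem hx hy

/-- **The twist preserves relations** (`[π]·` does: `KZ.of_mul_mem_relations`, KZProductIdeal).
[cite: KontsevichZagier2001, §1.2, §4.1] -/
theorem twistIdeal {P : ∀ n : ℕ, KZ.IntegralRep n → KZ.IntegralRep (n + 2)} (hP : IsDiscPad P)
    {c : KZ.FormalRep} (hc : c ∈ KZ.relations) : twist P c ∈ KZ.relations := by
  have h := KZ.relations.add_mem (twist_sub_mul_mem hP c) (KZ.of_mul_mem_relations KZ.piRep hc)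
  rwa [sub_add_cancel] at h

/-- **The Cauchy line is the disc** (landed `PiNormalisation`, stmt-KontsevichZagierPeriods-3384, KZ
eq. (1)): every `[ℝ, 1/(1+t²)]` differs from `[π] = KZ.piRep` by relations — the input of `stub_flatten`.
[cite: KontsevichZagier2001, §1.1 eq. (1)] -/
theorem cauchy_sub_piRep (c : KZ.IntegralRep 1) (hcd : c.domain = Set.univ)
    (hci : Set.EqOn c.integrand (fun x => 1 / (1 + x 0 ^ 2)) c.domain) :
    KZ.of c - KZ.of KZ.piRep ∈ KZ.relations :=
  (Summit.KontsevichZagierPeriods.CompiledSubstitutions.PiNormalisation.piNormalisation_proof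
    KZ.piRep rfl (fun _ _ => rfl)).1 c hcd hci

/-! ### LANDED INPUT 3 (sorry-free): padding a Nash cube by `[0,1]` is a move (slab Newton–Leibniz,
`KZ.IntegralRep.equivalent_slab`) and gives a Nash cube — replaces the climb by `TwistStable` -/

/-- One more unit-interval factor: a Nash cube of dimension `d` is congruent to a Nash cube of dimension
`d + 1` (the slab `s × [0,1]`, ONE Newton–Leibniz move). [cite: KontsevichZagier2001, §1.2 rule (3)] -/
theorem cubePad {d : ℕ} {s : KZ.IntegralRep d} (hs : IsNashCube d s) :
    ∃ s' : KZ.IntegralRep (d + 1), IsNashCube (d + 1) s' ∧ KZ.of s - KZ.of s' ∈ KZ.relations := by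
  obtain ⟨hdom, U, g, hUo, hcU, hgs, hga, hsg⟩ := hs
  have hinit : ∀ {z : Fin (d + 1) → ℝ}, z ∈ Set.pi Set.univ (fun _ : Fin (d + 1) => Set.Icc (0 : ℝ) 1) →
      Fin.init z ∈ Set.pi Set.univ (fun _ : Fin d => Set.Icc (0 : ℝ) 1) :=
    fun hz i _ => hz (Fin.castSucc i) (Set.mem_univ _)
  let initL : (Fin (d + 1) → ℝ) →L[ℝ] (Fin d → ℝ) :=
    ContinuousLinearMap.pi fun j => ContinuousLinearMap.proj (Fin.castSucc j)
  have hinitL : ∀ v, initL v = Fin.init v := fun v => rfl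
  refine ⟨s.slab 0, ⟨?_, {z | Fin.init z ∈ U}, fun z => g (Fin.init z), ?_, ?_, hgs.comp_init, ?_, ?_⟩,
    s.equivalent_slab 0⟩
  · ext z
    simp only [KZ.IntegralRep.domain_slab, KZ.IntegralRep.slabDomain, hdom, Set.mem_setOf_eq,
      Set.mem_univ_pi, Set.mem_Icc, Nat.cast_zero, zero_add, Fin.forall_fin_succ', Fin.init]
  · exact hUo.preimage initL.continuous
  · exact fun z hz => hcU (hinit hz)
  · intro z hz
    exact (hga (initL z) hz).comp (initL.analyticAt z)
  · intro z hz
    exact hsg (Fin.init z) (hinit hz)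

/-- Padding by `j` unit intervals. [cite: KontsevichZagier2001, §1.2 rule (3)] -/
theorem cubePad_add {d : ℕ} {s : KZ.IntegralRep d} (j : ℕ) (hs : IsNashCube d s) :
    ∃ s' : KZ.IntegralRep (d + j), IsNashCube (d + j) s' ∧ KZ.of s - KZ.of s' ∈ KZ.relations := by
  induction j with
  | zero => exact ⟨s, hs, by simp [KZ.relations.zero_mem]⟩
  | succ j ih =>
    obtain ⟨s₁, h₁, hr₁⟩ := ih
    obtain ⟨s₂, h₂, hr₂⟩ := cubePad h₁
    refine ⟨s₂, h₂, ?_⟩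
    have : KZ.of s - KZ.of s₂ = (KZ.of s - KZ.of s₁) + (KZ.of s₁ - KZ.of s₂) := by abel
    rw [this]
    exact KZ.relations.add_mem hr₁ hr₂

/-! ### Glue (sorry-free): `ℤ`-combinations of spherical representations of one dimension merge -/

/-- The zero density on `ℝ^{2m}` is a spherical representation and a relation.
[cite: KontsevichZagier2001, §1.2] -/
theorem exists_sph_zero (m : ℕ) :
    ∃ R₀ : KZ.IntegralRep (m * 2), Sph m R₀ ∧ KZ.of R₀ ∈ KZ.relations := by
  have hq : ∀ x ∈ (Set.univ : Set (Fin (m * 2) → ℝ)),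
      MvPolynomial.aeval x (1 : MvPolynomial (Fin (m * 2)) ℚ) ≠ 0 := by
    intro x _
    simp
  have hint : IntegrableOn (fun x : Fin (m * 2) → ℝ =>
      MvPolynomial.aeval x (0 : MvPolynomial (Fin (m * 2)) ℚ) /
        MvPolynomial.aeval x (1 : MvPolynomial (Fin (m * 2)) ℚ)) Set.univ := by
    simp
  obtain ⟨R₀, hd, hi⟩ : ∃ R₀ : KZ.IntegralRep (m * 2), R₀.domain = Set.univ ∧ ∀ x, R₀.integrand x = 0 :=
    ⟨KZ.IntegralRep.ofRational Set.univ 0 1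
      Literature.ModelTheory.ExponentialFields.isSemialgebraic_univ hq hint, rfl, fun x => by simp⟩
  refine ⟨R₀, ⟨hd, fun ε => ⟨fun _ => 0, fun _ => analyticAt_const, fun w _ => by rw [hi, zero_mul]⟩⟩, ?_⟩
  have hmem : KZ.of R₀ - KZ.of R₀ - KZ.of R₀ ∈ KZ.relations :=
    KZ.integrandAddRel_subset_relations ⟨m * 2, R₀, R₀, R₀, rfl, rfl, fun x _ => by simp [hi], rfl⟩
  simpa using hmem

/-- Two spherical representations of the same dimension add to one (one integrand-additivity move).
[cite: KontsevichZagier2001, §1.2] [cite: BochnakCosteRoy1998, Prop. 2.2.6] -/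
theorem exists_sph_add {m : ℕ} {R₁ R₂ : KZ.IntegralRep (m * 2)} (h₁ : Sph m R₁) (h₂ : Sph m R₂) :
    ∃ R : KZ.IntegralRep (m * 2), Sph m R ∧ KZ.of R₁ + KZ.of R₂ - KZ.of R ∈ KZ.relations := by
  obtain ⟨hd₁, hK₁⟩ := h₁
  obtain ⟨hd₂, hK₂⟩ := h₂
  have hsa : IsSemialgebraicFunOn ℚ (Set.univ : Set (Fin (m * 2) → ℝ))
      (R₁.integrand + R₂.integrand) := by
    have a := R₁.isSemialgebraicFunOn_integrand
    have b := R₂.isSemialgebraicFunOn_integrand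
    rw [hd₁] at a
    rw [hd₂] at b
    exact IsSemialgebraicFunOn.add_holds a b
  have hint : IntegrableOn (R₁.integrand + R₂.integrand) (Set.univ : Set (Fin (m * 2) → ℝ)) := by
    have a := R₁.integrableOn
    have b := R₂.integrableOn
    rw [hd₁] at a
    rw [hd₂] at b
    exact a.add b
  obtain ⟨R, hRd, hRi⟩ : ∃ R : KZ.IntegralRep (m * 2),
      R.domain = Set.univ ∧ R.integrand = R₁.integrand + R₂.integrand :=
    ⟨⟨Set.univ, R₁.integrand + R₂.integrand,
      Literature.ModelTheory.ExponentialFields.isSemialgebraic_univ, hsa, hint⟩, rfl, rfl⟩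
  refine ⟨R, ⟨hRd, fun ε => ?_⟩, ?_⟩
  · obtain ⟨K₁, hK₁a, hK₁e⟩ := hK₁ ε
    obtain ⟨K₂, hK₂a, hK₂e⟩ := hK₂ ε
    refine ⟨fun w => K₁ w + K₂ w, fun w => (hK₁a w).add (hK₂a w), fun w hw => ?_⟩
    show K₁ w + K₂ w = _
    rw [hK₁e w hw, hK₂e w hw, hRi, Pi.add_apply]
    ring
  · have hmem : KZ.of R - KZ.of R₁ - KZ.of R₂ ∈ KZ.relations :=
      KZ.integrandAddRel_subset_relations
        ⟨m * 2, R, R₁, R₂, hd₁.trans hRd.symm, hd₂.trans hRd.symm, fun x _ => by rw [hRi], rfl⟩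
    have : KZ.of R₁ + KZ.of R₂ - KZ.of R = -(KZ.of R - KZ.of R₁ - KZ.of R₂) := by abel
    rw [this]
    exact KZ.relations.neg_mem hmem

/-- Two spherical representations of the same dimension subtract to one (one integrand-additivity move:
`[ℝ^{2m}, f₁] = [ℝ^{2m}, f₂] + [ℝ^{2m}, f₁ − f₂]`). [cite: KontsevichZagier2001, §1.2]
[cite: BochnakCosteRoy1998, Prop. 2.2.6] -/
theorem exists_sph_sub {m : ℕ} {R₁ R₂ : KZ.IntegralRep (m * 2)} (h₁ : Sph m R₁) (h₂ : Sph m R₂) :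
    ∃ R : KZ.IntegralRep (m * 2), Sph m R ∧ KZ.of R₁ - KZ.of R₂ - KZ.of R ∈ KZ.relations := by
  obtain ⟨hd₁, hK₁⟩ := h₁
  obtain ⟨hd₂, hK₂⟩ := h₂
  have hsa : IsSemialgebraicFunOn ℚ (Set.univ : Set (Fin (m * 2) → ℝ))
      (R₁.integrand - R₂.integrand) := by
    have a := R₁.isSemialgebraicFunOn_integrand
    have b := R₂.isSemialgebraicFunOn_integrand
    rw [hd₁] at a
    rw [hd₂] at b
    exact IsSemialgebraicFunOn.sub_holds a b
  have hint : IntegrableOn (R₁.integrand - R₂.integrand) (Set.univ : Set (Fin (m * 2) → ℝ)) := by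
    have a := R₁.integrableOn
    have b := R₂.integrableOn
    rw [hd₁] at a
    rw [hd₂] at b
    exact a.sub b
  obtain ⟨R, hRd, hRi⟩ : ∃ R : KZ.IntegralRep (m * 2),
      R.domain = Set.univ ∧ R.integrand = R₁.integrand - R₂.integrand :=
    ⟨⟨Set.univ, R₁.integrand - R₂.integrand,
      Literature.ModelTheory.ExponentialFields.isSemialgebraic_univ, hsa, hint⟩, rfl, rfl⟩
  refine ⟨R, ⟨hRd, fun ε => ?_⟩, ?_⟩
  · obtain ⟨K₁, hK₁a, hK₁e⟩ := hK₁ ε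
    obtain ⟨K₂, hK₂a, hK₂e⟩ := hK₂ ε
    refine ⟨fun w => K₁ w - K₂ w, fun w => (hK₁a w).sub (hK₂a w), fun w hw => ?_⟩
    show K₁ w - K₂ w = _
    rw [hK₁e w hw, hK₂e w hw, hRi, Pi.sub_apply]
    ring
  · exact KZ.integrandAddRel_subset_relations
      ⟨m * 2, R₁, R₂, R, hd₂.trans hd₁.symm, hRd.trans hd₁.symm, fun x _ => by
        rw [hRi, Pi.add_apply, Pi.sub_apply]; ring, rfl⟩

/-- Integer multiples of a spherical representation are congruent to one spherical representation.
[cite: KontsevichZagier2001, §1.2] -/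
theorem exists_sph_zsmul {m : ℕ} {R : KZ.IntegralRep (m * 2)} (h : Sph m R) (ε : ℤ) :
    ∃ R' : KZ.IntegralRep (m * 2), Sph m R' ∧ ε • KZ.of R - KZ.of R' ∈ KZ.relations := by
  induction ε with
  | zero =>
    obtain ⟨R₀, h₀, hrel⟩ := exists_sph_zero m
    exact ⟨R₀, h₀, by simpa using hrel⟩
  | succ i ih =>
    obtain ⟨R₁, h₁, hrel₁⟩ := ih
    obtain ⟨R₂, h₂, hrel₂⟩ := exists_sph_add h₁ h
    refine ⟨R₂, h₂, ?_⟩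
    have : ((i : ℤ) + 1) • KZ.of R - KZ.of R₂ =
        ((i : ℤ) • KZ.of R - KZ.of R₁) + (KZ.of R₁ + KZ.of R - KZ.of R₂) := by
      rw [add_smul, one_smul]; abel
    rw [this]
    exact KZ.relations.add_mem hrel₁ hrel₂
  | pred i ih =>
    obtain ⟨R₁, h₁, hrel₁⟩ := ih
    obtain ⟨R₂, h₂, hrel₂⟩ := exists_sph_sub h₁ h
    refine ⟨R₂, h₂, ?_⟩
    have : (-(i : ℤ) - 1) • KZ.of R - KZ.of R₂ =
        ((-(i : ℤ)) • KZ.of R - KZ.of R₁) + (KZ.of R₁ - KZ.of R - KZ.of R₂) := by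
      rw [sub_smul, one_smul]; abel
    rw [this]
    exact KZ.relations.add_mem hrel₁ hrel₂

/-- `ℤ`-combinations of spherical representations of one dimension merge to one (induction on the sum).
[cite: KontsevichZagier2001, §1.2] -/
theorem exists_sph_zsum (m : ℕ) {ι : Type*} (s : Finset ι) (ε : ι → ℤ) (R : ι → KZ.IntegralRep (m * 2))
    (hR : ∀ j ∈ s, Sph m (R j)) :
    ∃ R₀ : KZ.IntegralRep (m * 2), Sph m R₀ ∧ ∑ j ∈ s, ε j • KZ.of (R j) - KZ.of R₀ ∈ KZ.relations := by
  classical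
  induction s using Finset.induction_on with
  | empty =>
    obtain ⟨R₀, h₀, hrel⟩ := exists_sph_zero m
    exact ⟨R₀, h₀, by simpa using hrel⟩
  | @insert a s ha ih =>
    obtain ⟨R₁, h₁, hrel₁⟩ := ih (fun j hj => hR j (Finset.mem_insert_of_mem hj))
    obtain ⟨Ra, ha', hrela⟩ := exists_sph_zsmul (hR a (Finset.mem_insert_self a s)) (ε a)
    obtain ⟨R₂, h₂, hrel₂⟩ := exists_sph_add ha' h₁
    refine ⟨R₂, h₂, ?_⟩
    rw [Finset.sum_insert ha]
    have : ε a • KZ.of (R a) + ∑ j ∈ s, ε j • KZ.of (R j) - KZ.of R₂ =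
        (∑ j ∈ s, ε j • KZ.of (R j) - KZ.of R₁) + (ε a • KZ.of (R a) - KZ.of Ra) +
          (KZ.of Ra + KZ.of R₁ - KZ.of R₂) := by abel
    rw [this]
    exact KZ.relations.add_mem (KZ.relations.add_mem hrel₁ hrela) hrel₂

/-! ### The composition (sorry-free) -/

/-- **Skeleton theorem, arrow form** (concludes the crux BY NAME; type
`stub_flatten-sig → stub_productSpin-sig → SpinNormalForm`, hypotheses spelled through the name-keyed
aliases). For a pinned `P` and `r` of dimension `n`: `[r] ≡ Σᵢ εᵢ [sᵢ]` with Nash cubes `sᵢ` of dimensions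
`dᵢ` (`cubeForm`, LANDED); `N₀ := Σᵢ dᵢ`; for `N ≥ N₀` pad each cube to dimension `N` (`cubePad_add`,
LANDED slab moves), push everything through `κ^N` (`twistIdeal`, LANDED product ideal), flatten (STUB F)
and spin (STUB S) each padded cube into a spherical `[Rᵢ]` of dimension `2N`, and merge
`Σᵢ εᵢ [Rᵢ] ≡ [R₀]` (`exists_sph_zsum`). No climb is needed: every `N ≥ N₀` is reached directly.
[cite: KontsevichZagier2001, §1.2] -/
theorem SpinNormalForm_of (h₁ : __Registered.stub_flatten) (h₂ : __Registered.stub_productSpin) :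
    SpinNormalForm := by
  rw [spinNormalForm_iff]
  intro P hP n r
  -- iterates of the twist: preserve relations, commute with `−` and `ℤ`-combinations
  have T_rel : ∀ (k : ℕ) (c : KZ.FormalRep), c ∈ KZ.relations →
      (⇑(twist P))^[k] c ∈ KZ.relations := by
    intro k
    induction k with
    | zero => intro c hc; simpa using hc
    | succ k ih =>
      intro c hc
      rw [Function.iterate_succ_apply']
      exact twistIdeal hP (ih c hc)
  have T_sub : ∀ (k : ℕ) (a b : KZ.FormalRep),
      (⇑(twist P))^[k] (a - b) = (⇑(twist P))^[k] a - (⇑(twist P))^[k] b := by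
    intro k
    induction k with
    | zero => intro a b; rfl
    | succ k ih =>
      intro a b
      rw [Function.iterate_succ_apply', Function.iterate_succ_apply', Function.iterate_succ_apply',
        ih, map_sub]
  have T_zsum : ∀ (k : ℕ) {ι : Type} (t : Finset ι) (e : ι → ℤ) (f : ι → KZ.FormalRep),
      (⇑(twist P))^[k] (∑ j ∈ t, e j • f j) = ∑ j ∈ t, e j • (⇑(twist P))^[k] (f j) := by
    intro k
    induction k with
    | zero => intro ι t e f; simp only [Function.iterate_zero, id_eq]
    | succ k ih =>
      intro ι t e f
      simp only [Function.iterate_succ_apply', ih, map_sum, map_zsmul]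
  -- (1) cube form (landed)
  obtain ⟨S, d, ε, s, hs, hdec⟩ := cubeForm n r
  refine ⟨∑ i, d i, fun N hN => ?_⟩
  -- (2) per piece: pad to dimension `N`, flatten, spin
  have piece : ∀ i : Fin S, ∃ R : KZ.IntegralRep (N * 2), Sph N R ∧
      (⇑(twist P))^[N] (KZ.of (s i)) - KZ.of R ∈ KZ.relations := by
    intro i
    have hle : d i ≤ N :=
      le_trans (Finset.single_le_sum (fun j _ => Nat.zero_le (d j)) (Finset.mem_univ i)) hN
    obtain ⟨j, hj⟩ := Nat.exists_eq_add_of_le hle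
    subst hj
    obtain ⟨s', hs', hss'⟩ := cubePad_add j (hs i)
    obtain ⟨F, hF, hTF⟩ := h₁ P hP (d i + j) s'
    obtain ⟨R, hR, hFR⟩ := h₂ (d i + j) s' hs' F hF
    refine ⟨R, hR, ?_⟩
    have ha : (⇑(twist P))^[d i + j] (KZ.of (s i)) - (⇑(twist P))^[d i + j] (KZ.of s') ∈
        KZ.relations := by
      rw [← T_sub]
      exact T_rel _ _ hss'
    have h := KZ.relations.add_mem (KZ.relations.add_mem ha hTF) hFR
    convert h using 1
    abel
  choose R hR hTR using piece
  -- (3) merge the `ℤ`-combination on the common domain `ℝ^{2N}`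
  obtain ⟨R₀, hR₀, hsum⟩ := exists_sph_zsum N Finset.univ ε R (fun j _ => hR j)
  refine ⟨N, R₀, hR₀, ?_⟩
  have ha : (⇑(twist P))^[N] (KZ.of r) - ∑ i, ε i • (⇑(twist P))^[N] (KZ.of (s i)) ∈ KZ.relations := by
    have := T_rel N _ hdec
    rwa [T_sub, T_zsum] at this
  have hb : ∑ i, ε i • (⇑(twist P))^[N] (KZ.of (s i)) - ∑ i, ε i • KZ.of (R i) ∈ KZ.relations := by
    rw [← Finset.sum_sub_distrib]
    exact sum_mem fun i _ => by
      rw [← smul_sub]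
      exact KZ.relations.zsmul_mem (hTR i) _
  have h := KZ.relations.add_mem (KZ.relations.add_mem ha hb) hsum
  convert h using 1
  abel

/-- **Skeleton theorem, by name**: `SpinNormalForm` from the two registered stubs (its only `sorryAx`
dependencies are `stub_flatten`, `stub_productSpin`). [cite: KontsevichZagier2001, §1.2] -/
theorem SpinNormalForm_skeleton : SpinNormalForm :=
  SpinNormalForm_of stub_flatten stub_productSpin

end Summit.KontsevichZagierPeriods.KontsevichZagierPeriods.Cruxes.SpinNormalForm.LandedCubes
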